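import Literature.Analysis.FluidPDE.NSEnstrophyPersistenceForced
import Literature.Analysis.FluidPDE.TaoH1LocalExistenceForced
import Literature.Analysis.FluidPDE.ClassicalSobolevUniqueness
import Literature.Analysis.FluidPDE.ClassicalSolutionGlue
import Literature.Analysis.FluidPDE.ClayForceTimeShift
import Literature.Analysis.FluidPDE.EnstrophyGronwall
import Literature.Analysis.FluidPDE.NSForcedH1Continuation
import Literature.Analysis.FluidPDE.TaoForcedEnergyBoundDischarge
import HarnessLib

/-!
# Lemarié-Rieusset 2016, Thm. 7.2 WITH force (the `H¹` blow-up alternative) from forced smooth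
# local existence: `lemarieRieusset2016_H1_continuation_forced` modulo F2

Analysis/FluidPDE proof file (cell `pub/ns-blowup`, seat `ns-blowup-lit` g10; bears_on the Literature
leaf hC `lemarieRieusset2016_H1_continuation_forced` (`NSForcedH1Continuation.lean`), consumed by the
E–C lane (`FluidComputer/DesignedBlowupSerrinDivergence`, `…/PalasekTowerSerrinDivergence`,
`…/SerrinDivergenceMaximalForced`) and by `NSForcedH1ContinuationOfLerayRate`, and the forced local
existence leaf F2 `tao2011_smooth_local_existence_forced` (`TaoH1LocalExistenceForced.lean`); WHAT THIS
IS NOT: not a statement about Navier–Stokes regularity or blow-up — a continuation criterion for a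
GIVEN classical solution, modulo ONE named fact taken as a hypothesis). No definitions, no named
facts:

* `lemarieRieusset2016_H1_continuation_forced_of_smooth_local_existence :
    tao2011_smooth_local_existence_forced → lemarieRieusset2016_H1_continuation_forced`.

## The argument (Lemarié-Rieusset 2016, proof of Thm. 7.2 via Thm. 7.3; Tao 2013, Thm. 5.4)

Let `(u, p)` be classical on `[0, T) × ℝ³` with Clay force `f`, Schwartz datum, finite energy and
Tao class on every closed sub-slab, and bounded enstrophy `∫|∇u(t)|² ≤ B` up to `T`.

1. UNIFORM `H¹` BOUND up to `T`: the `L²` part is Tao's forced energy bound (Lemma 8.1 WITH force — a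
   theorem of the tree, `tao2011_forced_finiteEnergy_energyBound_holds`) on every closed sub-slab,
   `∫|u(t)|² ≤ C (‖u₀‖₂ + ∫₀ᵀ‖f‖₂)²` (LR16 (11.10)); so `‖u(t)‖²_{H¹} ≤ A²` for ALL `t < T`. The
   force has `‖f(t)‖²_{H¹} ≤ B_f²` for `t ≥ 0` (Clay decay).
2. ONE STEP `h > 0` with Tao's smallness `(A + B_f h)⁴ h ≤ c ν³`, and a restart time
   `s = max(T/2, T - h/2) ∈ (0, T)` with `T - s < h`.
3. F2 from the datum `u(s)` (smooth, divergence free, `H^∞` by the Tao class on `[0, (s+T)/2]`) and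
   the shifted force `f(· + s)` (Schwartz on `[0, h]`): a classical `(ũ, p̃)` on `[0, h]` of Tao class.
   Uniqueness of classical solutions with bounded Sobolev norms
   (`IsClassicalNSSolutionOn.velocity_eq_of_hasBoundedSobolevNormsOn`, fact-free) on every
   `[0, δ'] ⊂ [0, T - s)` identifies `ũ` with the shifted flow `u(· + s)` on `[0, T - s)`.
4. Hence the translate `u(· + s)` extends past `T - s` (witness: the F2 piece on `[0, h)`,
   `h > T - s`), and `u` extends past `T` (`HasSmoothExtensionPast.of_translate`: translate back and
   glue, `ClassicalSolutionGlue`).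

The fact's hypothesis on `∂ₜu` is not used.

## Mathlib / tree search

Tree (`lean search`, reused by name): `tao2011_forced_finiteEnergy_energyBound_holds`
(`TaoForcedEnergyBoundDischarge`), `HasSmoothExtensionPast.of_translate`,
`IsClassicalNSSolutionOn.comp_add_right` (`ClassicalSolutionGlue`),
`IsClassicalNSSolutionOn.velocity_eq_of_hasBoundedSobolevNormsOn` (`ClassicalSobolevUniqueness`),
`IsSmoothOnHalfSpace.isSmoothSpaceTimeOn_Icc(_timeShift)`,
`HasRapidSpaceTimeDecay.hasUniformRapidDecayOn_Icc_timeShift` (`ClayForceTimeShift`,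
`TaoForcedUniquenessSchwartzForce`), `HasRapidSpaceTimeDecay.exists_lintegral_iteratedFDeriv_slice_sq_le_all`
(`NSEnstrophyPersistenceForced`); companion file `TaoForcedBoundedSobolevNormsOfLocalExistence` (J1 ⇐ F2, same restart pattern).
`lean search 'H1_continuation_forced_of|H1_continuation_forced_holds'`: no hits before this file.

## References

* P. G. Lemarié-Rieusset, *The Navier–Stokes Problem in the 21st Century*, CRC 2016, Thm. 7.2
  (p. 125) with Thm. 7.3 and (11.10). [`LemarieRieusset2016`]
* T. Tao, Anal. PDE 6 (2013) = arXiv:1108.1165, Thm. 5.4 (ii)+(iv) (arXiv Thm. 31, p. 18), Lemma 8.1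
  (arXiv Lemma 44). [`Tao2011`]
* J. T. Beale, T. Kato, A. Majda, Comm. Math. Phys. 94 (1984), §1 (continuation vocabulary).
  [`BealeKatoMajda1984`]
-/

noncomputable section

open MeasureTheory Set Function Filter Topology
open scoped ENNReal NNReal ContDiff

namespace Literature.Analysis.FluidPDE

namespace TaoForcedHC

variable {ν T : ℝ} {f u : ℝ → EuclideanSpace ℝ (Fin 3) → EuclideanSpace ℝ (Fin 3)}
  {p : ℝ → EuclideanSpace ℝ (Fin 3) → ℝ}

/-! ### Plumbing -/

/-- `∫⁻ ‖D⁰g‖ₑ² = ∫⁻ ‖g‖ₑ²`. [folklore] -/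
private theorem lintegral_iteratedFDeriv_zero_eq' {F : Type*} [NormedAddCommGroup F]
    [NormedSpace ℝ F] (g : EuclideanSpace ℝ (Fin 3) → F) :
    ∫⁻ x, ‖iteratedFDeriv ℝ 0 g x‖ₑ ^ 2 = ∫⁻ x, ‖g x‖ₑ ^ 2 :=
  lintegral_congr fun x => by rw [← ofReal_norm, norm_iteratedFDeriv_zero, ofReal_norm]

/-- `∫ |∇g|²_F ≤ 3 ∫ ‖D¹g‖²` on `ℝ³`. [folklore] -/
private theorem lintegral_frobenius_le_three_mul
    (g : EuclideanSpace ℝ (Fin 3) → EuclideanSpace ℝ (Fin 3)) :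
    ∫⁻ x, ENNReal.ofReal (FluidPDE.frobeniusNormSq (fderiv ℝ g x)) ≤
      3 * ∫⁻ x, ‖iteratedFDeriv ℝ 1 g x‖ₑ ^ 2 :=
  calc ∫⁻ x, ENNReal.ofReal (FluidPDE.frobeniusNormSq (fderiv ℝ g x))
      ≤ ∫⁻ x, 3 * ‖iteratedFDeriv ℝ 1 g x‖ₑ ^ 2 := lintegral_mono fun x => by
        rw [← ofReal_norm, norm_iteratedFDeriv_one, ofReal_norm]
        exact ofReal_frobeniusNormSq_le_three_mul_enorm_sq _
    _ = 3 * ∫⁻ x, ‖iteratedFDeriv ℝ 1 g x‖ₑ ^ 2 := lintegral_const_mul' _ _ (by norm_num)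

/-- **The `H¹` size of the slices of a Clay force**: one `B ≥ 0` with
`∫ ‖f(t)‖² + ∫ |∇f(t)|²_F ≤ B²` for all `t ≥ 0`. [cite: FeffermanClay2006, (5)] -/
theorem exists_H1_bound_force (hfs : IsSmoothOnHalfSpace f) (hfd : HasRapidSpaceTimeDecay f) :
    ∃ B : ℝ, 0 ≤ B ∧ ∀ t, 0 ≤ t → (∫⁻ x, ‖f t x‖ₑ ^ 2) +
      (∫⁻ x, ENNReal.ofReal (FluidPDE.frobeniusNormSq (fderiv ℝ (f t) x))) ≤ ENNReal.ofReal (B ^ 2) := by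
  obtain ⟨F₀, hF₀⟩ := hfd.exists_lintegral_iteratedFDeriv_slice_sq_le_all (μ := volume) hfs 0
  obtain ⟨F₁, hF₁⟩ := hfd.exists_lintegral_iteratedFDeriv_slice_sq_le_all (μ := volume) hfs 1
  refine ⟨Real.sqrt (F₀ + 3 * F₁), Real.sqrt_nonneg _, fun t ht => ?_⟩
  rw [Real.sq_sqrt (by positivity), ENNReal.ofReal_add (by positivity) (by positivity),
    ENNReal.ofReal_coe_nnreal, ENNReal.ofReal_mul (by norm_num), ENNReal.ofReal_coe_nnreal,
    show ENNReal.ofReal (3 : ℝ) = 3 by norm_num]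
  refine add_le_add (by rw [← lintegral_iteratedFDeriv_zero_eq']; exact hF₀ t ht) ?_
  exact (lintegral_frobenius_le_three_mul _).trans (by gcongr; exact hF₁ t ht)

/-- `‖f(t)‖_{L²} ≤ F₀^{1/2}` uniformly in `t ≥ 0` for a Clay force (the integrand of
`∫₀ᵀ ‖f(t)‖₂ dt`). [cite: FeffermanClay2006, (5)] -/
theorem exists_lintegral_sq_rpow_half_le (hfs : IsSmoothOnHalfSpace f) (hfd : HasRapidSpaceTimeDecay f) :
    ∃ M : ℝ≥0∞, M < ⊤ ∧ ∀ t, 0 ≤ t → (∫⁻ x, ‖f t x‖ₑ ^ 2) ^ (1 / 2 : ℝ) ≤ M := by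
  obtain ⟨F₀, hF₀⟩ := hfd.exists_lintegral_iteratedFDeriv_slice_sq_le_all (μ := volume) hfs 0
  refine ⟨(F₀ : ℝ≥0∞) ^ (1 / 2 : ℝ), ENNReal.rpow_lt_top_of_nonneg (by norm_num) ENNReal.coe_ne_top,
    fun t ht => ENNReal.rpow_le_rpow ?_ (by norm_num)⟩
  rw [← lintegral_iteratedFDeriv_zero_eq']
  exact hF₀ t ht

/-- **One step** with Tao's smallness: for `A, B ≥ 0` and `c, ν > 0` there is `h > 0` with
`(A + Bh)⁴ h ≤ c ν³`. [cite: Tao2011, Thm. 5.4 (ii) (arXiv Thm. 31)] -/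
theorem exists_small_step {A B c : ℝ} (hA : 0 ≤ A) (hB : 0 ≤ B) (hc : 0 < c) (hν : 0 < ν) :
    ∃ h : ℝ, 0 < h ∧ (A + B * h) ^ 4 * h ≤ c * ν ^ 3 := by
  set D : ℝ := (A + B + 1) ^ 4 with hD
  have hDpos : 0 < D := by positivity
  set h : ℝ := min 1 (c * ν ^ 3 / D) with hh
  have hhpos : 0 < h := lt_min one_pos (div_pos (by positivity) hDpos)
  have hh1 : h ≤ 1 := min_le_left _ _
  have hhD : D * h ≤ c * ν ^ 3 := by
    have : h ≤ c * ν ^ 3 / D := min_le_right _ _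
    rwa [le_div_iff₀ hDpos, mul_comm] at this
  refine ⟨h, hhpos, ?_⟩
  have h1 : A + B * h ≤ A + B + 1 := by nlinarith
  calc (A + B * h) ^ 4 * h ≤ D * h := by
        rw [hD]
        exact mul_le_mul_of_nonneg_right (pow_le_pow_left₀ (by positivity) h1 4) hhpos.le
    _ ≤ c * ν ^ 3 := hhD

/-! ### The uniform energy bound up to `T` -/

/-- **Uniform `L²` bound up to the end of the half-open slab** (Tao 2013 Lemma 8.1 WITH force on
every closed sub-slab; the right side `C (‖u₀‖₂ + ∫₀ᵀ‖f‖₂)²` does not depend on the sub-slab).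
[cite: Tao2011, Lemma 8.1 (arXiv Lemma 44)] [cite: LemarieRieusset2016, (11.10)] -/
theorem exists_uniform_energy_bound (hν : 0 < ν) (hT : 0 < T)
    (hsol : IsClassicalNSSolutionOn (Ico 0 T) ν f u p)
    (hE : ∀ T' ∈ Ioo 0 T, ∃ C : ℝ≥0∞, C < ⊤ ∧ ∀ t ∈ Icc 0 T', ∫⁻ x, ‖u t x‖ₑ ^ 2 ≤ C)
    (hfs : IsSmoothOnHalfSpace f) (hfd : HasRapidSpaceTimeDecay f) :
    ∃ E : ℝ≥0, ∀ t ∈ Ico 0 T, ∫⁻ x, ‖u t x‖ₑ ^ 2 ≤ E := by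
  obtain ⟨C, hCtop, hC⟩ := tao2011_forced_finiteEnergy_energyBound_holds
  obtain ⟨M, hMtop, hM⟩ := exists_lintegral_sq_rpow_half_le hfs hfd
  -- `∫ |u 0|² < ∞`
  obtain ⟨C₀, hC₀top, hC₀⟩ := hE (T / 2) ⟨by linarith, by linarith⟩
  have hu0 : ∫⁻ x, ‖u 0 x‖ₑ ^ 2 ≤ C₀ := hC₀ 0 ⟨le_rfl, by linarith⟩
  -- the uniform right-hand side
  set E : ℝ≥0∞ := C * (C₀ ^ (1 / 2 : ℝ) + M * ENNReal.ofReal T) ^ 2 with hEdef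
  have hEtop : E < ⊤ := by
    refine ENNReal.mul_lt_top hCtop (ENNReal.pow_lt_top (ENNReal.add_lt_top.2 ⟨?_, ?_⟩))
    · exact ENNReal.rpow_lt_top_of_nonneg (by norm_num) hC₀top.ne
    · exact ENNReal.mul_lt_top hMtop ENNReal.ofReal_lt_top
  refine ⟨E.toNNReal, fun t ht => ?_⟩
  rw [ENNReal.coe_toNNReal hEtop.ne]
  -- the closed sub-slab `[0, T']`, `T' = (t + T)/2`
  set T' : ℝ := (t + T) / 2 with hT'
  have hT'0 : 0 < T' := by rw [hT']; linarith [ht.1]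
  have hT'T : T' < T := by rw [hT']; linarith [ht.2]
  have htT' : t ∈ Icc 0 T' := ⟨ht.1, by rw [hT']; linarith [ht.2]⟩
  have hsol' : IsClassicalNSSolutionOn (Icc 0 T') ν f u p :=
    hsol.mono (fun s hs => ⟨hs.1, hs.2.trans_lt hT'T⟩) (uniqueDiffOn_Icc hT'0)
  obtain ⟨C', hC'top, hC'⟩ := hE T' ⟨hT'0, hT'T⟩
  have hfE' : ∫⁻ s in Icc 0 T', (∫⁻ x, ‖f s x‖ₑ ^ 2) ^ (1 / 2 : ℝ) ≤ M * ENNReal.ofReal T := by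
    calc ∫⁻ s in Icc 0 T', (∫⁻ x, ‖f s x‖ₑ ^ 2) ^ (1 / 2 : ℝ)
        ≤ ∫⁻ _ in Icc 0 T', M := setLIntegral_mono' measurableSet_Icc fun s hs => hM s hs.1
      _ = M * volume (Icc 0 T') := setLIntegral_const _ _
      _ ≤ M * ENNReal.ofReal T := by
          rw [Real.volume_Icc, sub_zero]
          exact mul_le_mul_right (ENNReal.ofReal_le_ofReal hT'T.le) _
  have h1 := (hC hν hT'0 hsol' (hfs.isSmoothSpaceTimeOn_Icc T')
    (hfE'.trans_lt (ENNReal.mul_lt_top hMtop ENNReal.ofReal_lt_top))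
    ⟨C'.toNNReal, fun s hs => by rw [ENNReal.coe_toNNReal hC'top.ne]; exact hC' s hs⟩).1 t htT'
  refine h1.trans ?_
  rw [hEdef]
  exact mul_le_mul_right (pow_le_pow_left' (add_le_add (ENNReal.rpow_le_rpow hu0 (by norm_num)) hfE') 2) _

/-! ### The main theorem -/

end TaoForcedHC

open TaoForcedHC in
/-- **Lemarié-Rieusset 2016, Thm. 7.2 WITH force (the `H¹` blow-up alternative), from forced smooth
local existence.** The named fact `lemarieRieusset2016_H1_continuation_forced` (a classical solution
on `[0, T)` with Clay data, Tao class on closed sub-slabs, finite energy and ENSTROPHY BOUNDED UP TO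
`T` extends smoothly past `T`) follows from `tao2011_smooth_local_existence_forced` (Tao 2013,
Thm. 5.4 (ii)+(iv) WITH force): the `H¹` norm is bounded up to `T` (energy bound + enstrophy
bound), so ONE restart from `u(s)`, `s = max(T/2, T - h/2)`, with the lifespan `h` of the local
theorem reaches past `T`; the local solution is the flow by uniqueness with bounded Sobolev norms,
and the extension is glued by `HasSmoothExtensionPast.of_translate`.
[cite: LemarieRieusset2016, Thm. 7.2 (p. 125) with Thm. 7.3 and (11.10)] [cite: Tao2011, Thm. 5.4 (ii)+(iv) (arXiv Thm. 31)] -/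
theorem lemarieRieusset2016_H1_continuation_forced_of_smooth_local_existence
    (hF : tao2011_smooth_local_existence_forced) : lemarieRieusset2016_H1_continuation_forced := by
  intro ν T hν hT f u p hsol hTao _hTao' hE _hu₀ hfs hfd hH1
  obtain ⟨c, hc, hloc⟩ := hF
  -- (1) uniform `H¹` bounds up to `T`
  obtain ⟨E, hEu⟩ := exists_uniform_energy_bound hν hT hsol hE hfs hfd
  obtain ⟨Bω, hBω⟩ := hH1
  set A : ℝ := Real.sqrt (E + Bω) with hAdef
  have hA : 0 ≤ A := Real.sqrt_nonneg _
  have hAu : ∀ t ∈ Ico 0 T, (∫⁻ x, ‖u t x‖ₑ ^ 2) +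
      (∫⁻ x, ENNReal.ofReal (FluidPDE.frobeniusNormSq (fderiv ℝ (u t) x))) ≤ ENNReal.ofReal (A ^ 2) := by
    intro t ht
    rw [hAdef, Real.sq_sqrt (by positivity), ENNReal.ofReal_add (by positivity) (by positivity),
      ENNReal.ofReal_coe_nnreal, ENNReal.ofReal_coe_nnreal]
    exact add_le_add (hEu t ht) (hBω t ht)
  obtain ⟨B, hB, hBf⟩ := exists_H1_bound_force hfs hfd
  -- (2) the step and the restart time
  obtain ⟨h, hh, hsmall⟩ := exists_small_step hA hB hc hν
  set s : ℝ := max (T / 2) (T - h / 2) with hsdef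
  have hs0 : 0 < s := lt_of_lt_of_le (by linarith) (le_max_left _ _)
  have hsT : s < T := max_lt (by linarith) (by linarith)
  have hTs : T - s < h := by
    have : T - h / 2 ≤ s := le_max_right _ _
    linarith
  have hsIco : s ∈ Ico 0 T := ⟨hs0.le, hsT⟩
  -- (3) F2 from the datum `u s` and the shifted force
  set T₁ : ℝ := (s + T) / 2 with hT₁
  have hT₁mem : T₁ ∈ Ioo 0 T := ⟨by rw [hT₁]; linarith, by rw [hT₁]; linarith⟩
  have hsT₁ : s ∈ Icc 0 T₁ := ⟨hs0.le, by rw [hT₁]; linarith⟩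
  have hHs : ∀ n : ℕ, ∫⁻ x, ‖iteratedFDeriv ℝ n (u s) x‖ₑ ^ 2 < ⊤ := fun n => by
    obtain ⟨C, hC⟩ := hTao T₁ hT₁mem n
    exact (hC s hsT₁).trans_lt ENNReal.coe_lt_top
  obtain ⟨v, q, hsol', hv0, hvb, -, -, -⟩ := hloc hν hh (hsol.contDiff_velocity hsIco)
    (hsol.divFree s hsIco) hHs (hfs.isSmoothSpaceTimeOn_Icc_timeShift hs0.le h)
    (hfd.hasUniformRapidDecayOn_Icc_timeShift hfs hs0.le hh) hA hB (hAu s hsIco)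
    (fun t ht => hBf (t + s) (by linarith [ht.1])) hsmall
  -- uniqueness on every closed `[0, δ'] ⊂ [0, T - s)`
  have heq : ∀ t ∈ Ico 0 (T - s), v t = u (t + s) := by
    intro t ht
    set δ : ℝ := (t + (T - s)) / 2 with hδ
    have hδ0 : 0 < δ := by rw [hδ]; linarith [ht.1, ht.2]
    have htδ : t ∈ Icc 0 δ := ⟨ht.1, by rw [hδ]; linarith [ht.2]⟩
    have hδT : s + δ < T := by rw [hδ]; linarith [ht.2]
    have hδh : δ ≤ h := by rw [hδ]; linarith [ht.2]
    -- the shifted flow on `[0, δ]`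
    have hshift : IsClassicalNSSolutionOn (Icc 0 δ) ν (fun r => f (r + s)) (fun r => u (r + s))
        (fun r => p (r + s)) :=
      (hsol.comp_add_right s).mono
        (fun r hr => show r + s ∈ Ico 0 T from ⟨by linarith [hr.1], by linarith [hr.2]⟩)
        (uniqueDiffOn_Icc hδ0)
    have hBshift : HasBoundedSobolevNormsOn (Icc 0 δ) (fun r => u (r + s)) := by
      intro n
      obtain ⟨C, hC⟩ := hTao (s + δ) ⟨by linarith, hδT⟩ n
      exact ⟨C, fun r hr => hC (r + s) ⟨by linarith [hr.1], by linarith [hr.2]⟩⟩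
    have hsolδ : IsClassicalNSSolutionOn (Icc 0 δ) ν (fun r => f (r + s)) v q :=
      hsol'.mono (Icc_subset_Icc_right hδh) (uniqueDiffOn_Icc hδ0)
    have h0 : (fun r => u (r + s)) 0 = v 0 := by simp [hv0]
    have := hshift.velocity_eq_of_hasBoundedSobolevNormsOn hsolδ hν.le hδ0 hBshift
      (hvb.mono (Icc_subset_Icc_right hδh)) h0 t htδ
    exact this.symm
  -- (4) the translate extends past `T - s`, hence `u` past `T`
  have hext : HasSmoothExtensionPast ν (fun t => f (t + s)) (fun t => u (t + s)) (T - s) :=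
    ⟨h, hTs, v, q, hsol'.mono Ico_subset_Icc_self (uniqueDiffOn_Ico 0 h), heq⟩
  exact HasSmoothExtensionPast.of_translate hsol hs0 hsT hext

end Literature.Analysis.FluidPDE

end
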